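import Mathlib
import Literature.MathematicalPhysics.QuantumLattice.WilsonDiracAP
import Literature.MathematicalPhysics.QuantumLattice.OverlapLocality
import Summits.QuantumFields.QCD.Theorems.QuarksAsStableActionUnquenchedChessboardBoundStubAxisSwapAux
import HarnessLib

/-!
# Hypercubic covariance of the antiperiodic Wilson determinant and of the Wilson action
(stub `stub_axisSwap` of crux stmt-QuantumFields-9735, line Sketch)

For the exchange `σ = (0 i)` of the time axis with the axis `i` of the four-torus, acting on a
lattice gauge field by `(σU)(x, j) = U(x ∘ σ, σ j)`, we prove

* `det D_AP[σU, m] = det D_AP[U, m]` (antiperiodic `r = 1` Wilson–Dirac operator, `SU(N)` quarks):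
  the antiperiodic lift commutes with `σ` (the seams `x_μ = -1` are permuted among themselves,
  `apLift_swap`); the forward hops of `σU` in direction `μ` are the forward hops of `U` in
  direction `σ μ` reindexed by the site permutation `θ : x ↦ x ∘ σ` (`linkHop_swap`); and the spin
  projectors `½(1 ∓ γ_μ)`, `½(1 ∓ γ_{σμ})` are conjugate under the invertible spin matrix
  `S = γ₅ (γ₀ - γ_i)` of the auxiliary file, so that `D_W[σV] = θ (S D_W[V] S⁻¹) θ` is a similarity
  followed by a reindexing (`wilsonDirac_swap`), and the determinant is unchanged
  (`det_wilsonDirac_swap`, `det_wilsonDiracAP_swap`).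
* Together with `S_W(σU) = S_W(U)` (`AxisSwap.wilsonAction_swap`, auxiliary file) this gives the
  registered stub `stub_axisSwap`.

The site permutation `θ` is written out as the `Equiv.Perm` of `x ↦ x ∘ σ`
(`Function.Involutive.toPerm`), extended by the identity on colour (and spin) indices.

References: K. Osterwalder, E. Seiler, Ann. Phys. 110 (1978) 440, §2; I. Montvay, G. Münster,
*Quantum Fields on a Lattice* (CUP 1994), §4.2 and App. 8.1.2.
-/

noncomputable section

open MeasureTheory Matrix Complex Finset
open Literature.MathematicalPhysics.QuantumFieldTheory Literature.MathematicalPhysics.QuantumLattice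
open Literature.Probability.LatticeModels
open scoped ComplexConjugate BigOperators ComplexOrder Kronecker

namespace Summit.QuantumFields.QCD.Theorems.UnquenchedChessboardBoundLine

namespace AxisSwap

/-! ## The Wilson–Dirac operator under the coordinate exchange: a similarity and a reindexing -/

section Hop

variable {L N : ℕ} {G : Type*} [Group G] (ρ : G →* Matrix (Fin N) (Fin N) ℂ)

/-- The spinor lifts of `S_i` and `S_i⁻¹` are inverse to each other (`i ≠ 0`). -/
theorem spinorLift_spinS_mul_spinS' [NeZero L] {i : Fin 4} (hi : i ≠ 0) :
    spinorLift (L := L) (N := N) (gammaFive * (euclideanGamma 0 - euclideanGamma i)) *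
        spinorLift (L := L) (N := N)
          ((2 : ℂ)⁻¹ • ((euclideanGamma 0 - euclideanGamma i) * gammaFive)) = 1 := by
  unfold spinorLift
  rw [← Matrix.mul_kronecker_mul, ← Matrix.mul_kronecker_mul, Matrix.mul_one, Matrix.mul_one,
    spinS_mul_spinS' hi, Matrix.one_kronecker_one, Matrix.one_kronecker_one]

/-- **Conjugating a re-associated Kronecker product by spinor lifts acts on the spin factor
only.** -/
theorem spinorLift_mul_reindex_kronecker_mul [NeZero L] (A B Y : Matrix (Fin 4) (Fin 4) ℂ)
    (X : Matrix (TorusSite 4 L × Fin N) (TorusSite 4 L × Fin N) ℂ) :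
    spinorLift (L := L) (N := N) A *
        Matrix.reindex (Equiv.prodAssoc _ _ _) (Equiv.prodAssoc _ _ _) (X ⊗ₖ Y) *
          spinorLift (L := L) (N := N) B =
      Matrix.reindex (Equiv.prodAssoc _ _ _) (Equiv.prodAssoc _ _ _) (X ⊗ₖ (A * Y * B)) := by
  -- adapted from `spinorLift_mul_reindex_kronecker_mul_spinorLift`
  -- (Summits/QuantumFields/QCD/Theorems/TipPricing/Negative/ReflectionSimilarity.lean)
  have he : ∀ Γ : Matrix (Fin 4) (Fin 4) ℂ,
      (spinorLift Γ : Matrix (TorusSite 4 L × Fin N × Fin 4) (TorusSite 4 L × Fin N × Fin 4) ℂ) =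
        Matrix.reindex (Equiv.prodAssoc _ _ _) (Equiv.prodAssoc _ _ _)
          ((1 : Matrix (TorusSite 4 L × Fin N) (TorusSite 4 L × Fin N) ℂ) ⊗ₖ Γ) := fun Γ => by
    rw [← Matrix.one_kronecker_one, Matrix.kronecker_assoc]
    rfl
  rw [he, he]
  simp only [Matrix.reindex_apply, Matrix.submatrix_mul_equiv, ← Matrix.mul_kronecker_mul,
    Matrix.one_mul, Matrix.mul_one]

/-- Re-associated Kronecker products commute with the site exchange (which acts on the first
factor only). -/
theorem submatrix_reindex_kronecker (i : Fin 4)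
    (X : Matrix (TorusSite 4 L × Fin N) (TorusSite 4 L × Fin N) ℂ) (Y : Matrix (Fin 4) (Fin 4) ℂ) :
    (Matrix.reindex (Equiv.prodAssoc _ _ _) (Equiv.prodAssoc _ _ _) (X ⊗ₖ Y)).submatrix
        ⇑(Equiv.prodCongr (Function.Involutive.toPerm
          (fun x : TorusSite 4 L => x ∘ ⇑(Equiv.swap (0 : Fin 4) i)) (comp_swap_involutive i))
          (Equiv.refl (Fin N × Fin 4)))
        ⇑(Equiv.prodCongr (Function.Involutive.toPerm
          (fun x : TorusSite 4 L => x ∘ ⇑(Equiv.swap (0 : Fin 4) i)) (comp_swap_involutive i))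
          (Equiv.refl (Fin N × Fin 4))) =
      Matrix.reindex (Equiv.prodAssoc _ _ _) (Equiv.prodAssoc _ _ _)
        ((X.submatrix
          ⇑(Equiv.prodCongr (Function.Involutive.toPerm
          (fun x : TorusSite 4 L => x ∘ ⇑(Equiv.swap (0 : Fin 4) i)) (comp_swap_involutive i))
          (Equiv.refl (Fin N)))
          ⇑(Equiv.prodCongr (Function.Involutive.toPerm
          (fun x : TorusSite 4 L => x ∘ ⇑(Equiv.swap (0 : Fin 4) i)) (comp_swap_involutive i))
          (Equiv.refl (Fin N)))) ⊗ₖ Y) := by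
  ext ⟨x, a, α⟩ ⟨y, b, β⟩
  rfl

/-- `reindex` along one equivalence is additive. -/
theorem reindex_add_same {m n α : Type*} [Add α] (e : m ≃ n) (A B : Matrix m m α) :
    Matrix.reindex e e (A + B) = Matrix.reindex e e A + Matrix.reindex e e B := rfl

/-- `submatrix` along one map is additive. -/
theorem submatrix_add_same {m n α : Type*} [Add α] (f : m → n) (A B : Matrix n n α) :
    (A + B).submatrix f f = A.submatrix f f + B.submatrix f f := rfl

/-- `submatrix` along one map distributes over subtraction. -/
theorem submatrix_sub_same {m n α : Type*} [Sub α] (f : m → n) (A B : Matrix n n α) :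
    (A - B).submatrix f f = A.submatrix f f - B.submatrix f f := rfl

/-- `submatrix` along one map commutes with scalars. -/
theorem submatrix_smul_same {m n R α : Type*} [SMul R α] (f : m → n) (c : R) (A : Matrix n n α) :
    (c • A).submatrix f f = c • A.submatrix f f := rfl

/-- `submatrix` along one map distributes over finite sums. -/
theorem submatrix_sum_same {m n ι α : Type*} [AddCommMonoid α] (s : Finset ι) (f : m → n)
    (A : ι → Matrix n n α) :
    (∑ k ∈ s, A k).submatrix f f = ∑ k ∈ s, (A k).submatrix f f := by
  ext a b
  simp only [Matrix.submatrix_apply, Matrix.sum_apply]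

/-- **The forward hops of the exchanged field** in direction `μ` are the forward hops of the field
in direction `σ μ`, reindexed by the site exchange. -/
theorem linkHop_swap (V : GaugeConfig 4 L G) (i μ : Fin 4) :
    linkHop ρ (fun e : Edge 4 L =>
        V (e.1 ∘ ⇑(Equiv.swap (0 : Fin 4) i), Equiv.swap (0 : Fin 4) i e.2)) μ =
      (linkHop ρ V (Equiv.swap (0 : Fin 4) i μ)).submatrix
        ⇑(Equiv.prodCongr (Function.Involutive.toPerm
          (fun x : TorusSite 4 L => x ∘ ⇑(Equiv.swap (0 : Fin 4) i)) (comp_swap_involutive i))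
          (Equiv.refl (Fin N)))
        ⇑(Equiv.prodCongr (Function.Involutive.toPerm
          (fun x : TorusSite 4 L => x ∘ ⇑(Equiv.swap (0 : Fin 4) i)) (comp_swap_involutive i))
          (Equiv.refl (Fin N))) := by
  ext ⟨x, a⟩ ⟨y, b⟩
  simp only [linkHop, Matrix.submatrix_apply, Matrix.of_apply, Equiv.prodCongr_apply, Prod.map,
    Equiv.coe_refl, id_eq, Function.Involutive.coe_toPerm]
  by_cases h : y = Site.shift x μ
  · rw [if_pos h, if_pos ((eq_shift_iff_comp_swap i x y μ).mp h)]
  · rw [if_neg h, if_neg (mt (eq_shift_iff_comp_swap i x y μ).mpr h)]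

/-- **The Wilson hopping matrices of the exchanged field**:
`W_μ(σV) = θ (S W_{σμ}(V) S⁻¹) θ`. -/
theorem wilsonHop_swap [NeZero L] (V : GaugeConfig 4 L G) {i : Fin 4} (hi : i ≠ 0) (μ : Fin 4) :
    wilsonHop ρ (fun e : Edge 4 L =>
        V (e.1 ∘ ⇑(Equiv.swap (0 : Fin 4) i), Equiv.swap (0 : Fin 4) i e.2)) μ =
      (spinorLift (L := L) (N := N) (gammaFive * (euclideanGamma 0 - euclideanGamma i)) *
        wilsonHop ρ V (Equiv.swap (0 : Fin 4) i μ) *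
          spinorLift (L := L) (N := N)
            ((2 : ℂ)⁻¹ • ((euclideanGamma 0 - euclideanGamma i) * gammaFive))).submatrix
        ⇑(Equiv.prodCongr (Function.Involutive.toPerm
          (fun x : TorusSite 4 L => x ∘ ⇑(Equiv.swap (0 : Fin 4) i)) (comp_swap_involutive i))
          (Equiv.refl (Fin N × Fin 4)))
        ⇑(Equiv.prodCongr (Function.Involutive.toPerm
          (fun x : TorusSite 4 L => x ∘ ⇑(Equiv.swap (0 : Fin 4) i)) (comp_swap_involutive i))
          (Equiv.refl (Fin N × Fin 4))) := by
  rw [wilsonHop, wilsonHop, linkHop_swap ρ V i μ, Matrix.conjTranspose_submatrix, reindex_add_same,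
    reindex_add_same, Matrix.mul_add, Matrix.add_mul, spinorLift_mul_reindex_kronecker_mul,
    spinorLift_mul_reindex_kronecker_mul, spinS_conj_chiralProjMinus hi,
    spinS_conj_chiralProjPlus hi, Equiv.swap_apply_self, submatrix_add_same,
    submatrix_reindex_kronecker, submatrix_reindex_kronecker]

/-- **The Wilson–Dirac operator of the exchanged field** (`r = 1`, unitary colour representation)
is a spin similarity followed by the site reindexing: `D_W[σV] = θ (S D_W[V] S⁻¹) θ`. -/
theorem wilsonDirac_swap [NeZero L] (hρ : ∀ g, ρ g ∈ Matrix.unitaryGroup (Fin N) ℂ)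
    (V : GaugeConfig 4 L G) {i : Fin 4} (hi : i ≠ 0) (m : ℝ) :
    wilsonDirac ρ (fun e : Edge 4 L =>
        V (e.1 ∘ ⇑(Equiv.swap (0 : Fin 4) i), Equiv.swap (0 : Fin 4) i e.2)) m 1 =
      (spinorLift (L := L) (N := N) (gammaFive * (euclideanGamma 0 - euclideanGamma i)) *
        wilsonDirac ρ V m 1 *
          spinorLift (L := L) (N := N)
            ((2 : ℂ)⁻¹ • ((euclideanGamma 0 - euclideanGamma i) * gammaFive))).submatrix
        ⇑(Equiv.prodCongr (Function.Involutive.toPerm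
          (fun x : TorusSite 4 L => x ∘ ⇑(Equiv.swap (0 : Fin 4) i)) (comp_swap_involutive i))
          (Equiv.refl (Fin N × Fin 4)))
        ⇑(Equiv.prodCongr (Function.Involutive.toPerm
          (fun x : TorusSite 4 L => x ∘ ⇑(Equiv.swap (0 : Fin 4) i)) (comp_swap_involutive i))
          (Equiv.refl (Fin N × Fin 4))) := by
  -- adapted from `wilsonDirac_negReflect`
  -- (Summits/QuantumFields/QCD/Theorems/TipPricing/Negative/ReflectionSimilarity.lean)
  rw [wilsonDirac_eq_sub_sum_wilsonHop ρ hρ, wilsonDirac_eq_sub_sum_wilsonHop ρ hρ, Matrix.mul_sub,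
    Matrix.sub_mul, Matrix.mul_smul, Matrix.mul_one, Matrix.smul_mul,
    spinorLift_spinS_mul_spinS' hi, Finset.mul_sum, Finset.sum_mul, submatrix_sub_same,
    submatrix_smul_same, submatrix_sum_same, Matrix.submatrix_one_equiv]
  congr 1
  exact Fintype.sum_equiv (Equiv.swap (0 : Fin 4) i) _ _ fun μ => wilsonHop_swap ρ V hi μ

/-- **Hypercubic covariance of the Wilson fermion determinant**: exchanging the time axis with the
axis `i` on sites and directions does not change `det D_W` (`r = 1`, unitary colour
representation). -/
theorem det_wilsonDirac_swap [NeZero L] (hρ : ∀ g, ρ g ∈ Matrix.unitaryGroup (Fin N) ℂ)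
    (V : GaugeConfig 4 L G) (i : Fin 4) (m : ℝ) :
    (wilsonDirac ρ (fun e : Edge 4 L =>
        V (e.1 ∘ ⇑(Equiv.swap (0 : Fin 4) i), Equiv.swap (0 : Fin 4) i e.2)) m 1).det =
      (wilsonDirac ρ V m 1).det := by
  by_cases hi : i = 0
  · subst hi
    simp only [Equiv.swap_self, Equiv.coe_refl, Function.comp_id, id_eq, Prod.mk.eta]
  · rw [wilsonDirac_swap ρ hρ V hi m, Matrix.det_submatrix_equiv_self, Matrix.det_mul,
      Matrix.det_mul, mul_right_comm, ← Matrix.det_mul, spinorLift_spinS_mul_spinS' hi,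
      Matrix.det_one, one_mul]

/-- **The antiperiodic lift commutes with the coordinate exchange**: the seam condition
`x_μ = -1` of the link `(x, μ)` is carried to itself (`(x ∘ σ) (σ μ) = x μ`). -/
theorem apLift_swap (U : GaugeConfig 4 L (Matrix.specialUnitaryGroup (Fin N) ℂ)) (i : Fin 4) :
    apLift (N := N) (fun e : Edge 4 L =>
        U (e.1 ∘ ⇑(Equiv.swap (0 : Fin 4) i), Equiv.swap (0 : Fin 4) i e.2)) =
      fun e : Edge 4 L =>
        apLift U (e.1 ∘ ⇑(Equiv.swap (0 : Fin 4) i), Equiv.swap (0 : Fin 4) i e.2) := by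
  funext e
  simp only [apLift, Function.comp_apply, Equiv.swap_apply_self]

/-- **Hypercubic covariance of the antiperiodic Wilson determinant** `det D_AP` (`SU(N)` quarks). -/
theorem det_wilsonDiracAP_swap [NeZero L]
    (U : GaugeConfig 4 L (Matrix.specialUnitaryGroup (Fin N) ℂ)) (i : Fin 4) (m : ℝ) :
    (wilsonDiracAP (fun e : Edge 4 L =>
        U (e.1 ∘ ⇑(Equiv.swap (0 : Fin 4) i), Equiv.swap (0 : Fin 4) i e.2)) m).det =
      (wilsonDiracAP U m).det := by
  rw [wilsonDiracAP_def, wilsonDiracAP_def, apLift_swap]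
  exact det_wilsonDirac_swap _ unitaryFundamentalRep_mem_unitaryGroup _ i m

end Hop

end AxisSwap

/-! ## The stub -/

/-- **Stub `axisSwap`.** Exchanging the time axis with axis `i` on sites and directions,
`(σU)(x, j) = U(x ∘ swap 0 i, swap 0 i j)`, leaves the antiperiodic Wilson determinant and the
Wilson action invariant: the seams `x_μ = -1` are permuted among themselves, the site permutation
conjugates `D_W` into the operator with permuted `γ`-matrices, which is spinor-conjugate to `D_W`
(`S = γ₅ (γ₀ - γ_i)` realises the transposition on the Euclidean Clifford generators), and
plaquettes go to plaquettes up to orientation (`Re tr` is orientation blind). -/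
theorem stub_axisSwap {L : ℕ} [NeZero L] (i : Fin 4)
    (U : GaugeConfig 4 L (Matrix.specialUnitaryGroup (Fin 3) ℂ)) (m : ℝ) :
    (wilsonDiracAP (fun e : Edge 4 L =>
        U (e.1 ∘ Equiv.swap (0 : Fin 4) i, Equiv.swap (0 : Fin 4) i e.2)) m).det =
      (wilsonDiracAP U m).det ∧
    wilsonAction (fundamentalRep (Fin 3)) (fun e : Edge 4 L =>
        U (e.1 ∘ Equiv.swap (0 : Fin 4) i, Equiv.swap (0 : Fin 4) i e.2)) =
      wilsonAction (fundamentalRep (Fin 3)) U :=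
  ⟨AxisSwap.det_wilsonDiracAP_swap U i m,
    AxisSwap.wilsonAction_swap (fundamentalRep (Fin 3)) (continuous_fundamentalRep (Fin 3)) U i⟩

end Summit.QuantumFields.QCD.Theorems.UnquenchedChessboardBoundLine

end
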